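import Summits.QuantumFields.BalabanUV.Beta.FP.TorusCompositeCovarianceOneRows

/-!
# `BalabanUV.Beta.FP.TorusCompositeCovarianceTwoDefect` — road «FP» for binder row D1, ROUTE T, (COV-m) ORDER 2: **THE LOCATED COST OF AN INNER-SECOND-JET SUMMAND IN
# THE COMPOSITE SECOND CHAIN RULE** (E-1 of leaf-02 g25's ONLINE, made kernel-visible): a summand `stepIns₁ M′ Lc (rs 1) v · compRows^{low}` (the top step's FIRST jet
# along ANY lower vector `v` — e.g. the lower composite's second jet `compIns₁^{low}(h)·h`) feeds the composite door's generator columns `W₀ = towerGen` with a LOWER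
# block `(c_{lev 1}·σ_n) • Qstep · (v b · evalN^{low}(itRoot_n(b₊)))_{b,e}`, whose leading sub-block is the top step's averaging rows on the RESIDUAL TIP CONTACT of `v`
# one level down — NOT zero; so #21's `c2` (right block `0`) admits no such summand, whence the ♭ recursion of `FP/TorusCompositeCovarianceTwo` (three summands)

WHAT ([folklore] finite sums BY NAME over C1∕C2 and leaf-06's tower objects; no `def`, no `def … : Prop`, nothing cited, 0 sorry).
* §1 `evalN_itRoot_top_zero ∕ _succ`: the LEADING block of the lower tower's point-evaluation matrix at the iterated root of a point `q` of the intermediate torus is the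
  residual indicator `[q = t̄]` (`quo_itRoot`) — NOT zero off the roots (contrast C2's `evalN_itRoot_rootPt`: at iterated roots of ROOT points every lower mode vanishes).
* §2 **`innerJet_summand_mul_towerGen_low`**: `(stepIns₁ M′ Lc (rs 1) v · compRows^{low}) · towerGen^{low}` (the lower generator block of #21's `W₀`)
  `= (c_{lev 1}·σ_n) • (Qstep · of (b e ↦ v b · evalN^{low} (itRoot_n (wrapPt (b.1 + e_{b.2}))) e))` — C1's `compRows_mul_tgrad` + `stepIns₁_mul_tgrad` through
  `towerGen = D·evalN` (C2 §1): the tip contact lands on the iterated roots of the (generically NON-root) tips `b₊`, the far-root contact dies (`evalN_itRoot_rootPt`).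
READING (zero weight; the label is PART THREE's junction's, R-D1-g44-3): with §1, the `Res`-sub-block of §2 is `(c_{lev 1}σ_n) • Qstep · Tip_res(v)` — the depth-≥2
face of g24's F-2 ∕ D2DET: the inner second jet cannot ride in the averaging's composite second jet if `c2`'s right block is to vanish.

HONEST DEPENDENCY (page 1, mandatory): continuum YM on T⁴ ⇐ BetaPertH ∧ nine spine estimates (0/9 proved); BetaPertH ⇐ (D1) ∧ (D4) ∧ CAP+tail;
G-an2-4 gates asym, D1 and NE2/3/4.  HONEST FRAMING (cell contract, verbatim): «discharging `BetaPertH` makes Bałaban's UV stability UNCONDITIONAL —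
a real constructive-QFT result; it is NOT the continuum limit and NOT the Clay problem.»  ABSOLUTE RULE (cell charter, verbatim): «No internally-minted
statement may enter as a cited fact. Every hypothesis is either kernel-proved in this package or a verbatim quotation of a PUBLISHED theorem with page
reference. The manuscript(s) under audit are NOT citable for their own disputed steps — they are the thing under adjudication; programme-internal
(2001/route/tribunal) claims are never citable.»  0 estimates; 0∕4 row-D1 binders; NOT (T-ID), NOT SDF, NOT D1, NOT BetaPertH, NOT continuum, NOT Clay.
D1 formalisation swarm LEAF PROVER 02 (b2b-balaban-beta-d1-formalise-leaf-02 gen 25), 2026-08-23.  No existing file touched.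
-/

noncomputable section

open scoped BigOperators

namespace Summit.QuantumFields.BalabanUV.Beta.FP.TorusCompositeCovarianceTwoDefect

open Matrix Finset
open Literature.MathematicalPhysics.QuantumFieldTheory
open Literature.MathematicalPhysics.QuantumFieldTheory.Balaban1983to89
open Literature.MathematicalPhysics.QuantumFieldTheory.Balaban1983to89.Beta
open B5Prop11Plancherel (fine)
open B6Lemma24Torus (pbox mem_pbox)
open AffineAveraging (Site box toSite unitVec)
open LatticeForm (quo)
open OneStepResolventKernel (Fib)
open Summit.QuantumFields.BalabanUV.Beta.BorderedHessian (stepScale)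
open Summit.QuantumFields.BalabanUV.Beta.FP.KernelPeriodisationFib (Idx)
open Summit.QuantumFields.BalabanUV.Beta.FP.TorusGaugeCovariance (tdelta tgrad)
open Summit.QuantumFields.BalabanUV.Beta.FP.TorusGaugeCovariancePairing (wrapPt wrapPt_of_mem)
open Summit.QuantumFields.BalabanUV.Beta.FP.TorusCombRows (Res)
open Summit.QuantumFields.BalabanUV.Beta.FP.TorusCompositeObjects
open Summit.QuantumFields.BalabanUV.Beta.FP.TorusCompositeFP (evalN evalN_zero evalN_succ)
open Summit.QuantumFields.BalabanUV.Beta.FP.TorusCompositeCovariance (rootPt itRoot itRoot_zero itRoot_succ quo_itRoot)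
open Summit.QuantumFields.BalabanUV.Beta.FP.TorusCompositeCovarianceOne (tdelta_wrapPt of_tdelta_mul stepIns₁ stepIns₁_mul_tgrad compRows_mul_tgrad)
open Summit.QuantumFields.BalabanUV.Beta.FP.TorusCompositeCovarianceOneRows (towerGen_eq_tgrad_mul_evalN evalN_itRoot_rootPt)

variable {d : ℕ} (Lc : ℕ) [NeZero Lc]

/-! ## §1 The leading block of the lower point-evaluation matrix at an iterated root: the residual indicator -/

omit [NeZero Lc] in
/-- [folklore] depth `0`: the point-evaluation matrix at (the trivial iterated root of) a point `q` is the residual indicator `[q = t̄]`. -/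
theorem evalN_itRoot_top_zero (F : Fin (d + 1) → ℕ) [∀ μ, NeZero (F μ)] (rs : ℕ → (Fin (d + 1) → ℕ)) (hrs : ∀ k, rs k ∈ box (d + 1) Lc) (q : ↥(pbox F))
    (t : Res (toSite (rs 0)) Lc F) :
    evalN Lc F rs 0 (fun s : ↥(pbox (towerTorus Lc F 0)) => (s : Site (d + 1))) (itRoot Lc F rs hrs 0 q) t = tdelta F (q : Site (d + 1)) t.1 := by
  rw [evalN_zero, itRoot_zero, Matrix.of_apply]

/-- [folklore] depth `k+1`: the LEADING (top-comb) block of the lower tower's point-evaluation matrix at the iterated root of a point `q` reads `[quo (Lc^{k+1}) (itRoot q) = t̄]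
= [q = t̄]` (`quo_itRoot`) — NOT zero when `q` is a residual point (contrast `evalN_itRoot_rootPt`). -/
theorem evalN_itRoot_top_succ (k : ℕ) (F : Fin (d + 1) → ℕ) [∀ μ, NeZero (F μ)] (rs : ℕ → (Fin (d + 1) → ℕ)) (hrs : ∀ k, rs k ∈ box (d + 1) Lc) (q : ↥(pbox F))
    (t : Res (toSite (rs 0)) Lc F) :
    evalN Lc F rs (k + 1) (fun s : ↥(pbox (towerTorus Lc F (k + 1))) => (s : Site (d + 1))) (itRoot Lc F rs hrs (k + 1) q) (Sum.inl t)
      = tdelta F (q : Site (d + 1)) t.1 := by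
  rw [evalN_succ, Matrix.fromCols_apply_inl, Matrix.of_apply, bigRatio_eq_pow, quo_itRoot]

/-! ## §2 The inner-second-jet summand's lower block against the composite generators -/

section Defect

variable (M' : Fin (d + 1) → ℕ) [∀ μ, NeZero (M' μ)] (lev : ℕ → ℕ) (rs : ℕ → (Fin (d + 1) → ℕ))

/-- [folklore] **`innerJet_summand_mul_towerGen_low` — AN INNER-SECOND-JET SUMMAND AGAINST THE LOWER COMPOSITE GENERATORS.**  For ANY vector `v` on the bonds of the
intermediate torus `fine Lc M′` (e.g. the lower composite's second jet `compIns₁^{low}(h)·h`), the candidate chain-rule summand `stepIns₁ M′ Lc (rs 1) v · compRows^{low}`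
read against the LOWER generator block `towerGen^{low}` of #21's `W₀` (`W₀ = fromCols D_top towerGen^{low}`, `towerGen_succ`; #21's `hW2`) is
`(c_{lev 1}·σ_n) • Qstep · of (b e ↦ v b · evalN^{low}(itRoot_n(wrapPt (b.1 + e_{b.2}))) e)` (`σ_n = ∏_{i<n} stepScale d Lc (lev (i+2))·#B`, `c_{lev 1} = (Lc^{d+1}·stepScale d Lc
(lev 1))⁻¹`): the tip contact of C1's one-step law lands on the iterated roots of the TIPS `b₊` (generically residual points — §1 reads the leading block as
`Qstep·Tip_res(v)`), the far-root contact dies on the lower modes (`evalN_itRoot_rootPt`).  Hence a second chain rule with such a summand cannot satisfy #21's `c2`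
(right block `0`) — the located content of the ♭ choice in `FP/TorusCompositeCovarianceTwo`. -/
theorem innerJet_summand_mul_towerGen_low (hrs : ∀ k, rs k ∈ box (d + 1) Lc) (n : ℕ) (v : ↥(pbox (fine Lc M')) × Fin (d + 1) → ℝ) :
    (stepIns₁ M' Lc (rs 1) v * compRows Lc (fine Lc M') (fun k => lev (k + 1)) (fun k => rs (k + 1)) n) * towerGen Lc (fine Lc M') (fun k => rs (k + 1)) n
      = ((((Lc : ℝ) ^ (d + 1) * stepScale d Lc (lev 1))⁻¹) * (∏ i ∈ range n, (stepScale d Lc (lev (i + 1 + 1)) * ((box (d + 1) Lc).card : ℝ)))) •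
          (Qstep Lc M' (lev 1) (rs 1)
            * Matrix.of (fun (b : ↥(pbox (fine Lc M')) × Fin (d + 1)) (e : NParam Lc (fine Lc M') (fun k => rs (k + 1)) n) =>
                v b * evalN Lc (fine Lc M') (fun k => rs (k + 1)) n (fun s : ↥(pbox (towerTorus Lc (fine Lc M') n)) => (s : Site (d + 1)))
                  (itRoot Lc (fine Lc M') (fun k => rs (k + 1)) (fun k => hrs (k + 1)) n (wrapPt (fine Lc M') ((b.1 : Site (d + 1)) + unitVec b.2))) e)) := by
  -- the three contact compositions: tip × iterated-root indicator, then × the lower modes; far root × … dies on the lower modes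
  have tipR : Matrix.of (fun (b : ↥(pbox (fine Lc M')) × Fin (d + 1)) (t : ↥(pbox (fine Lc M'))) => v b * tdelta (fine Lc M') ((b.1 : Site (d + 1)) + unitVec b.2) t)
        * Matrix.of (fun (u : ↥(pbox (fine Lc M'))) (s : ↥(pbox (towerTorus Lc (fine Lc M') n))) =>
            tdelta (towerTorus Lc (fine Lc M') n)
              ((itRoot Lc (fine Lc M') (fun k => rs (k + 1)) (fun k => hrs (k + 1)) n u : ↥(pbox (towerTorus Lc (fine Lc M') n))) : Site (d + 1)) s)
      = Matrix.of (fun (b : ↥(pbox (fine Lc M')) × Fin (d + 1)) (s : ↥(pbox (towerTorus Lc (fine Lc M') n))) =>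
          v b * tdelta (towerTorus Lc (fine Lc M') n)
            ((itRoot Lc (fine Lc M') (fun k => rs (k + 1)) (fun k => hrs (k + 1)) n
                (wrapPt (fine Lc M') ((b.1 : Site (d + 1)) + unitVec b.2)) : ↥(pbox (towerTorus Lc (fine Lc M') n))) : Site (d + 1)) s) := by
    rw [of_tdelta_mul (fine Lc M')]
    rfl
  have tipRE : Matrix.of (fun (b : ↥(pbox (fine Lc M')) × Fin (d + 1)) (s : ↥(pbox (towerTorus Lc (fine Lc M') n))) =>
          v b * tdelta (towerTorus Lc (fine Lc M') n)
            ((itRoot Lc (fine Lc M') (fun k => rs (k + 1)) (fun k => hrs (k + 1)) n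
                (wrapPt (fine Lc M') ((b.1 : Site (d + 1)) + unitVec b.2)) : ↥(pbox (towerTorus Lc (fine Lc M') n))) : Site (d + 1)) s)
        * evalN Lc (fine Lc M') (fun k => rs (k + 1)) n (fun s : ↥(pbox (towerTorus Lc (fine Lc M') n)) => (s : Site (d + 1)))
      = Matrix.of (fun (b : ↥(pbox (fine Lc M')) × Fin (d + 1)) (e : NParam Lc (fine Lc M') (fun k => rs (k + 1)) n) =>
          v b * evalN Lc (fine Lc M') (fun k => rs (k + 1)) n (fun s : ↥(pbox (towerTorus Lc (fine Lc M') n)) => (s : Site (d + 1)))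
            (itRoot Lc (fine Lc M') (fun k => rs (k + 1)) (fun k => hrs (k + 1)) n (wrapPt (fine Lc M') ((b.1 : Site (d + 1)) + unitVec b.2))) e) := by
    rw [of_tdelta_mul (towerTorus Lc (fine Lc M') n)]
    ext b e
    simp only [Matrix.of_apply, wrapPt_of_mem]
  have farRE : Matrix.of (fun (a : ↥(pbox M') × Fin (d + 1)) (t : ↥(pbox (fine Lc M'))) =>
          (Qstep Lc M' (lev 1) (rs 1) *ᵥ v) a * tdelta (fine Lc M') ((rootPt M' Lc (hrs 1) (wrapPt M' ((a.1 : Site (d + 1)) + unitVec a.2)) : ↥(pbox (fine Lc M'))) : Site (d + 1)) t)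
        * Matrix.of (fun (u : ↥(pbox (fine Lc M'))) (s : ↥(pbox (towerTorus Lc (fine Lc M') n))) =>
            tdelta (towerTorus Lc (fine Lc M') n)
              ((itRoot Lc (fine Lc M') (fun k => rs (k + 1)) (fun k => hrs (k + 1)) n u : ↥(pbox (towerTorus Lc (fine Lc M') n))) : Site (d + 1)) s)
        * evalN Lc (fine Lc M') (fun k => rs (k + 1)) n (fun s : ↥(pbox (towerTorus Lc (fine Lc M') n)) => (s : Site (d + 1))) = 0 := by
    rw [show Matrix.of (fun (a : ↥(pbox M') × Fin (d + 1)) (t : ↥(pbox (fine Lc M'))) =>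
          (Qstep Lc M' (lev 1) (rs 1) *ᵥ v) a * tdelta (fine Lc M') ((rootPt M' Lc (hrs 1) (wrapPt M' ((a.1 : Site (d + 1)) + unitVec a.2)) : ↥(pbox (fine Lc M'))) : Site (d + 1)) t)
        * Matrix.of (fun (u : ↥(pbox (fine Lc M'))) (s : ↥(pbox (towerTorus Lc (fine Lc M') n))) =>
            tdelta (towerTorus Lc (fine Lc M') n)
              ((itRoot Lc (fine Lc M') (fun k => rs (k + 1)) (fun k => hrs (k + 1)) n u : ↥(pbox (towerTorus Lc (fine Lc M') n))) : Site (d + 1)) s)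
        = Matrix.of (fun (a : ↥(pbox M') × Fin (d + 1)) (s : ↥(pbox (towerTorus Lc (fine Lc M') n))) =>
          (Qstep Lc M' (lev 1) (rs 1) *ᵥ v) a * tdelta (towerTorus Lc (fine Lc M') n)
            ((itRoot Lc (fine Lc M') (fun k => rs (k + 1)) (fun k => hrs (k + 1)) n
                (rootPt M' Lc (hrs 1) (wrapPt M' ((a.1 : Site (d + 1)) + unitVec a.2))) : ↥(pbox (towerTorus Lc (fine Lc M') n))) : Site (d + 1)) s)
        from by rw [of_tdelta_mul (fine Lc M')]; ext a s; simp only [Matrix.of_apply, wrapPt_of_mem],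
      of_tdelta_mul (towerTorus Lc (fine Lc M') n)]
    ext a e
    simp only [Matrix.of_apply, Matrix.zero_apply, wrapPt_of_mem, evalN_itRoot_rootPt, mul_zero]
  -- the same three, with the top step's averaging rows in front (no reassociation needed below)
  have tipR' : Qstep Lc M' (lev 1) (rs 1)
        * Matrix.of (fun (b : ↥(pbox (fine Lc M')) × Fin (d + 1)) (t : ↥(pbox (fine Lc M'))) => v b * tdelta (fine Lc M') ((b.1 : Site (d + 1)) + unitVec b.2) t)
        * Matrix.of (fun (u : ↥(pbox (fine Lc M'))) (s : ↥(pbox (towerTorus Lc (fine Lc M') n))) =>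
            tdelta (towerTorus Lc (fine Lc M') n)
              ((itRoot Lc (fine Lc M') (fun k => rs (k + 1)) (fun k => hrs (k + 1)) n u : ↥(pbox (towerTorus Lc (fine Lc M') n))) : Site (d + 1)) s)
        * evalN Lc (fine Lc M') (fun k => rs (k + 1)) n (fun s : ↥(pbox (towerTorus Lc (fine Lc M') n)) => (s : Site (d + 1)))
      = Qstep Lc M' (lev 1) (rs 1)
        * Matrix.of (fun (b : ↥(pbox (fine Lc M')) × Fin (d + 1)) (e : NParam Lc (fine Lc M') (fun k => rs (k + 1)) n) =>
          v b * evalN Lc (fine Lc M') (fun k => rs (k + 1)) n (fun s : ↥(pbox (towerTorus Lc (fine Lc M') n)) => (s : Site (d + 1)))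
            (itRoot Lc (fine Lc M') (fun k => rs (k + 1)) (fun k => hrs (k + 1)) n (wrapPt (fine Lc M') ((b.1 : Site (d + 1)) + unitVec b.2))) e) := by
    rw [Matrix.mul_assoc (Qstep Lc M' (lev 1) (rs 1)), tipR, Matrix.mul_assoc, tipRE]
  rw [towerGen_eq_tgrad_mul_evalN Lc n (fine Lc M') (fun k => rs (k + 1)), ← Matrix.mul_assoc, Matrix.mul_assoc (stepIns₁ M' Lc (rs 1) v),
    compRows_mul_tgrad Lc n (fine Lc M') _ _ (fun k => hrs (k + 1)), Matrix.mul_smul, ← Matrix.mul_assoc, stepIns₁_mul_tgrad M' Lc (hrs 1) (lev 1)]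
  simp only [Matrix.smul_mul, smul_smul, Matrix.sub_mul]
  rw [tipR', farRE, sub_zero, mul_comm]

end Defect

end Summit.QuantumFields.BalabanUV.Beta.FP.TorusCompositeCovarianceTwoDefect

end
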